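import Mathlib.Analysis.Convex.Contractible
import Mathlib.Analysis.Complex.Convex
import Literature.Topology.FourManifolds.OpenTraceSimplyConnected
import Literature.Computation.FiniteGraph.SAWInterlacing
import HarnessLib

/-!
# Finite-graph witness engine, XII: simply connected lattice domains (boxes, and unions of site
# sets that are locally one-sided), decided by kernel checks

Topic `Literature/Computation/FiniteGraph`; everything proved, no facts. Part XI reduces a
`BoundaryTP2` counterexample on the site-list domain `Ω_S = siteDomain {x | toPair x ∈ S}` to one
Boolean plus the hypothesis `SimplyConnectedSpace Ω_S`. This file discharges that hypothesis for the
domains refuters actually search (boxes, L/T/U-shapes, slit and notched boxes, combs — every shape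
obtained by gluing boxes one at a time along box-shaped overlaps):

* `siteDomain_inter` — `siteDomain (A ∩ B) = siteDomain A ∩ siteDomain B` (always);
* `anchor z`, `supClose_anchor`, `eq_or_eq_of_supClose` — the sites sup-close to a point `z` form a
  product `{m₀[, m₀+1]} × {m₁[, m₁+1]}` anchored at `m = anchor z = (⌈Re z − ½⌉, ⌈Im z − ½⌉)`;
* `shapePairs`, `locallyOneSidedB S₁ S₂` and **`siteDomain_union_eq_of_locallyOneSided`** — if every
  such local product set of sites contained in `S₁ ∪ S₂` is contained in `S₁` or in `S₂` (a finite
  check over anchors in `S₁ ++ S₂`), then `siteDomain (S₁ ∪ S₂) = siteDomain S₁ ∪ siteDomain S₂`;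
* `openRect`, `siteDomain_boxList_eq_openRect`, **`isSimplyConnected_siteDomain_boxList`** — a box of
  sites spans an open rectangle, convex hence simply connected (and path connected);
* **`isSimplyConnected_siteDomain_append_of_check`** — gluing: if `Ω_{S₁}` is simply connected and
  `glueBoxCheck S₁ a b c d` accepts (`S₁`, `boxList a b` locally one-sided; their common sites are
  exactly the nonempty box `boxList c d`), then `Ω_{S₁ ++ boxList a b}` is simply connected — by the
  tree's set form of van Kampen's easy half (`isSimplyConnected_union_of_isOpen`, Hatcher Lemma 1.15,
  vendored under `Literature/Topology/FourManifolds`; imported, not re-proved);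
* `simplyConnectedSpace_of_isSimplyConnected` glue and the box instance of part XI's certificate,
  **`not_tp2_forall_of_boxCheck`** (hypothesis-free on `x_c ∈ [1/3, 1/2]`).

[folklore] throughout; the domains are those of Duminil-Copin–Hongler–Nolin 2011 §2.2 as rendered
by the tree's `LatticeDobrushin` / `siteDomain`.

## References
* A. Hatcher, *Algebraic Topology*, CUP 2002, Lemma 1.15 [HatcherAT2002].
* H. Duminil-Copin, C. Hongler, P. Nolin, CPAM 64 (2011), §2.2 [DuminilCopinHonglerNolin2011].
-/

noncomputable section

namespace Literature.Computation.FiniteGraph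

open Set Literature.Probability.LatticeModels Literature.Probability.RandomPlanarGeometry
open Literature.Probability.RandomPlanarGeometry.SAW.FiniteMemory (toPair toPair_injective)
open Literature.Topology.FourManifolds (isSimplyConnected_union_of_isOpen)

/-! ### Intersections -/

/-- `siteDomain` commutes with intersections. [folklore] -/
theorem siteDomain_inter (A B : Set (Site 2)) : siteDomain (A ∩ B) = siteDomain A ∩ siteDomain B := by
  ext z
  simp only [mem_siteDomain_iff, mem_inter_iff]
  exact ⟨fun h => ⟨fun x hx => (h x hx).1, fun x hx => (h x hx).2⟩, fun h x hx => ⟨h.1 x hx, h.2 x hx⟩⟩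

/-- `siteDomain` is monotone. [folklore] -/
theorem siteDomain_mono {A B : Set (Site 2)} (h : A ⊆ B) : siteDomain A ⊆ siteDomain B :=
  fun _ hz x hx => h (hz x hx)

/-! ### The sites sup-close to a point: a product anchored at `⌈· − ½⌉` -/

/-- The anchor site of a point: coordinates `⌈coordC z i − ½⌉`. [folklore] -/
def anchor (z : ℂ) : Site 2 := fun i => ⌈coordC z i - 1 / 2⌉

/-- The anchor is sup-close. [folklore] -/
theorem supClose_anchor (z : ℂ) : SupClose z (anchor z) := by
  intro i
  simp only [anchor]
  rw [abs_le]
  constructor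
  · have := Int.ceil_lt_add_one (coordC z i - 1 / 2); linarith
  · have := Int.le_ceil (coordC z i - 1 / 2); linarith

/-- A sup-close site has each coordinate equal to the anchor's or one more. [folklore] -/
theorem eq_or_eq_of_supClose {z : ℂ} {x : Site 2} (hx : SupClose z x) (i : Fin 2) :
    x i = anchor z i ∨ x i = anchor z i + 1 := by
  have h := hx i
  rw [abs_le] at h
  simp only [anchor]
  have h1 : (⌈coordC z i - 1 / 2⌉ : ℤ) ≤ x i := Int.ceil_le.2 (by linarith [h.1, h.2])
  have h2 : ((x i : ℤ) : ℝ) ≤ (⌈coordC z i - 1 / 2⌉ : ℤ) + 1 := by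
    have := Int.le_ceil (coordC z i - 1 / 2); linarith [h.1, h.2]
  have h2' : x i ≤ ⌈coordC z i - 1 / 2⌉ + 1 := by exact_mod_cast h2
  omega

/-- Sup-closeness is a coordinatewise condition, so coordinates of sup-close sites can be mixed.
[folklore] -/
theorem supClose_mix {z : ℂ} {x y : Site 2} (hx : SupClose z x) (hy : SupClose z y) :
    SupClose z ![x 0, y 1] := by
  intro i
  fin_cases i
  · simpa using hx 0
  · simpa using hy 1

/-- The local product shapes of integer pairs anchored at `m`: `{m₀[, m₀+1]} × {m₁[, m₁+1]}`.
[folklore] -/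
def shapePairs (m : ℤ × ℤ) : Bool → Bool → List (ℤ × ℤ)
  | false, false => [m]
  | true, false => [m, (m.1 + 1, m.2)]
  | false, true => [m, (m.1, m.2 + 1)]
  | true, true => [m, (m.1 + 1, m.2), (m.1, m.2 + 1), (m.1 + 1, m.2 + 1)]

/-- Membership in a local shape. [folklore] -/
theorem mem_shapePairs_iff {m p : ℤ × ℤ} {e₀ e₁ : Bool} :
    p ∈ shapePairs m e₀ e₁ ↔ (p.1 = m.1 ∨ (e₀ = true ∧ p.1 = m.1 + 1)) ∧ (p.2 = m.2 ∨ (e₁ = true ∧ p.2 = m.2 + 1)) := by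
  obtain ⟨p1, p2⟩ := p
  obtain ⟨m1, m2⟩ := m
  cases e₀ <;> cases e₁ <;> simp [shapePairs, Prod.ext_iff] <;> omega

/-- **Local one-sidedness** of two site lists: every local product shape (anchored at a site of
`S₁ ++ S₂`) that is contained in `S₁ ∪ S₂` is contained in `S₁` or in `S₂`. [folklore] -/
def locallyOneSidedB (S₁ S₂ : List (ℤ × ℤ)) : Bool :=
  (S₁ ++ S₂).all fun m => [false, true].all fun e₀ => [false, true].all fun e₁ =>
    !((shapePairs m e₀ e₁).all fun p => decide (p ∈ S₁) || decide (p ∈ S₂)) ||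
      ((shapePairs m e₀ e₁).all fun p => decide (p ∈ S₁)) || ((shapePairs m e₀ e₁).all fun p => decide (p ∈ S₂))

/-- The site set of a list of integer pairs. [folklore] -/
def sitesOf (S : List (ℤ × ℤ)) : Set (Site 2) := {x | toPair x ∈ S}

/-- [folklore] -/
@[simp] theorem mem_sitesOf {S : List (ℤ × ℤ)} {x : Site 2} : x ∈ sitesOf S ↔ toPair x ∈ S := Iff.rfl

/-- [folklore] -/
theorem sitesOf_append (S₁ S₂ : List (ℤ × ℤ)) : sitesOf (S₁ ++ S₂) = sitesOf S₁ ∪ sitesOf S₂ := by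
  ext x; simp [sitesOf]

/-- **Union under local one-sidedness**: `siteDomain (S₁ ∪ S₂) = siteDomain S₁ ∪ siteDomain S₂`.
[folklore] -/
theorem siteDomain_union_eq_of_locallyOneSided {S₁ S₂ : List (ℤ × ℤ)} (h : locallyOneSidedB S₁ S₂ = true) :
    siteDomain (sitesOf S₁ ∪ sitesOf S₂) = siteDomain (sitesOf S₁) ∪ siteDomain (sitesOf S₂) := by
  classical
  refine Subset.antisymm ?_ (union_subset (siteDomain_mono subset_union_left) (siteDomain_mono subset_union_right))
  intro z hz
  -- the shape of the sites sup-close to `z`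
  set m := anchor z with hm
  set e₀ : Bool := decide (SupClose z ![m 0 + 1, m 1]) with he₀
  set e₁ : Bool := decide (SupClose z ![m 0, m 1 + 1]) with he₁
  -- every listed pair of the shape is sup-close, hence in `S₁ ∪ S₂`
  have hclose : ∀ p ∈ shapePairs (toPair m) e₀ e₁, SupClose z (ofPair p) := by
    intro p hp
    rw [mem_shapePairs_iff] at hp
    obtain ⟨h0, h1⟩ := hp
    have hx0 : SupClose z ![p.1, m 1] := by
      rcases h0 with h0 | ⟨he, h0⟩
      · have : (![p.1, m 1] : Site 2) = m := by
          funext i; fin_cases i <;> simp [h0, toPair]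
        rw [this]; exact supClose_anchor z
      · have hd : SupClose z ![m 0 + 1, m 1] := by simpa [he₀] using he
        have : (![p.1, m 1] : Site 2) = ![m 0 + 1, m 1] := by
          funext i; fin_cases i <;> simp [h0, toPair]
        rw [this]; exact hd
    have hx1 : SupClose z ![m 0, p.2] := by
      rcases h1 with h1 | ⟨he, h1⟩
      · have : (![m 0, p.2] : Site 2) = m := by
          funext i; fin_cases i <;> simp [h1, toPair]
        rw [this]; exact supClose_anchor z
      · have hd : SupClose z ![m 0, m 1 + 1] := by simpa [he₁] using he
        have : (![m 0, p.2] : Site 2) = ![m 0, m 1 + 1] := by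
          funext i; fin_cases i <;> simp [h1, toPair]
        rw [this]; exact hd
    have := supClose_mix hx0 hx1
    have heq : (![(![p.1, m 1] : Site 2) 0, (![m 0, p.2] : Site 2) 1] : Site 2) = ofPair p := by
      funext i; fin_cases i <;> simp [ofPair]
    rwa [heq] at this
  have hin : ∀ p ∈ shapePairs (toPair m) e₀ e₁, p ∈ S₁ ∨ p ∈ S₂ := by
    intro p hp
    have := hz (ofPair p) (hclose p hp)
    simpa [sitesOf] using this
  -- every sup-close site is listed in the shape
  have hshape : ∀ x, SupClose z x → toPair x ∈ shapePairs (toPair m) e₀ e₁ := by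
    intro x hx
    rw [mem_shapePairs_iff]
    simp only [toPair]
    constructor
    · rcases eq_or_eq_of_supClose hx 0 with h0 | h0
      · exact Or.inl h0
      · refine Or.inr ⟨?_, h0⟩
        rw [he₀, decide_eq_true_eq]
        have := supClose_mix hx (supClose_anchor z)
        have heq : (![x 0, anchor z 1] : Site 2) = ![m 0 + 1, m 1] := by
          funext i; fin_cases i <;> simp [h0, hm]
        rwa [heq] at this
    · rcases eq_or_eq_of_supClose hx 1 with h1 | h1
      · exact Or.inl h1
      · refine Or.inr ⟨?_, h1⟩
        rw [he₁, decide_eq_true_eq]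
        have := supClose_mix (supClose_anchor z) hx
        have heq : (![anchor z 0, x 1] : Site 2) = ![m 0, m 1 + 1] := by
          funext i; fin_cases i <;> simp [h1, hm]
        rwa [heq] at this
  -- the anchor is a listed site, so the check applies to this shape
  have hmS : toPair m ∈ S₁ ++ S₂ := by
    have := hz m (supClose_anchor z)
    simpa [sitesOf] using this
  simp only [locallyOneSidedB, List.all_eq_true, Bool.or_eq_true, Bool.not_eq_true', List.all_eq_false,
    decide_eq_true_eq] at h
  have hcases := h (toPair m) hmS e₀ (by cases e₀ <;> simp) e₁ (by cases e₁ <;> simp)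
  rcases hcases with (hnot | hS₁) | hS₂
  · -- impossible: the shape IS inside `S₁ ∪ S₂`
    exfalso
    obtain ⟨p, hp, hnp⟩ := hnot
    exact hnp (hin p hp)
  · exact Or.inl fun x hx => hS₁ _ (hshape x hx)
  · exact Or.inr fun x hx => hS₂ _ (hshape x hx)

/-! ### Boxes are open rectangles, hence simply connected -/

/-- The open rectangle `(a₀ − ½, b₀ + ½) × (a₁ − ½, b₁ + ½)`. [folklore] -/
def openRect (a b : ℤ × ℤ) : Set ℂ :=
  {z : ℂ | ((a.1 : ℝ) - 1 / 2 < z.re ∧ z.re < (b.1 : ℝ) + 1 / 2) ∧ ((a.2 : ℝ) - 1 / 2 < z.im ∧ z.im < (b.2 : ℝ) + 1 / 2)}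

/-- The site set of `boxList` is the tree's `boxSites`. [folklore] -/
theorem sitesOf_boxList (a b : ℤ × ℤ) : sitesOf (boxList a b) = boxSites (ofPair a) (ofPair b) := by
  ext x
  rw [mem_sitesOf, mem_boxSites_iff_toPair, toPair_ofPair, toPair_ofPair]

/-- **The site-square domain of a box of sites is the open rectangle around it.** [folklore] -/
theorem siteDomain_boxList_eq_openRect (a b : ℤ × ℤ) : siteDomain (sitesOf (boxList a b)) = openRect a b := by
  ext z
  rw [mem_siteDomain_iff]
  simp only [mem_sitesOf, mem_boxList_iff]
  constructor
  · intro h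
    have hlo := h ![⌈z.re - 1 / 2⌉, ⌈z.im - 1 / 2⌉] (by
      refine Fin.forall_fin_two.2 ⟨?_, ?_⟩
      · simp only [coordC_zero, Matrix.cons_val_zero]
        rw [abs_le]
        constructor
        · have := Int.ceil_lt_add_one (z.re - 1 / 2); linarith
        · have := Int.le_ceil (z.re - 1 / 2); linarith
      · simp only [coordC_one, Matrix.cons_val_one, Matrix.cons_val_zero]
        rw [abs_le]
        constructor
        · have := Int.ceil_lt_add_one (z.im - 1 / 2); linarith
        · have := Int.le_ceil (z.im - 1 / 2); linarith)
    have hhi := h ![⌊z.re + 1 / 2⌋, ⌊z.im + 1 / 2⌋] (by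
      refine Fin.forall_fin_two.2 ⟨?_, ?_⟩
      · simp only [coordC_zero, Matrix.cons_val_zero]
        rw [abs_le]
        constructor
        · have := Int.floor_le (z.re + 1 / 2); linarith
        · have := Int.lt_floor_add_one (z.re + 1 / 2); linarith
      · simp only [coordC_one, Matrix.cons_val_one, Matrix.cons_val_zero]
        rw [abs_le]
        constructor
        · have := Int.floor_le (z.im + 1 / 2); linarith
        · have := Int.lt_floor_add_one (z.im + 1 / 2); linarith)
    simp only [toPair, Matrix.cons_val_zero, Matrix.cons_val_one] at hlo hhi
    obtain ⟨h0, -, h1, -⟩ := hlo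
    obtain ⟨-, h2, -, h3⟩ := hhi
    refine ⟨⟨?_, ?_⟩, ?_, ?_⟩
    · have hc : ((a.1 : ℤ) : ℝ) ≤ (⌈z.re - 1 / 2⌉ : ℝ) := by exact_mod_cast h0
      have := Int.ceil_lt_add_one (z.re - 1 / 2)
      linarith
    · have hc : ((⌊z.re + 1 / 2⌋ : ℤ) : ℝ) ≤ (b.1 : ℝ) := by exact_mod_cast h2
      have := Int.lt_floor_add_one (z.re + 1 / 2)
      linarith
    · have hc : ((a.2 : ℤ) : ℝ) ≤ (⌈z.im - 1 / 2⌉ : ℝ) := by exact_mod_cast h1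
      have := Int.ceil_lt_add_one (z.im - 1 / 2)
      linarith
    · have hc : ((⌊z.im + 1 / 2⌋ : ℤ) : ℝ) ≤ (b.2 : ℝ) := by exact_mod_cast h3
      have := Int.lt_floor_add_one (z.im + 1 / 2)
      linarith
  · rintro ⟨⟨hr1, hr2⟩, hi1, hi2⟩ x hx
    have hx0 := hx 0
    have hx1 := hx 1
    simp only [coordC_zero, coordC_one] at hx0 hx1
    rw [abs_le] at hx0 hx1
    simp only [toPair]
    refine ⟨?_, ?_, ?_, ?_⟩
    · have h' : ((a.1 : ℤ) : ℝ) - 1 < (x 0 : ℝ) := by linarith [hx0.1, hx0.2]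
      have h'' : (a.1 : ℤ) - 1 < x 0 := by exact_mod_cast h'
      omega
    · have h' : (x 0 : ℝ) < (b.1 : ℝ) + 1 := by linarith [hx0.1, hx0.2]
      have h'' : x 0 < b.1 + 1 := by exact_mod_cast h'
      omega
    · have h' : ((a.2 : ℤ) : ℝ) - 1 < (x 1 : ℝ) := by linarith [hx1.1, hx1.2]
      have h'' : (a.2 : ℤ) - 1 < x 1 := by exact_mod_cast h'
      omega
    · have h' : (x 1 : ℝ) < (b.2 : ℝ) + 1 := by linarith [hx1.1, hx1.2]
      have h'' : x 1 < b.2 + 1 := by exact_mod_cast h'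
      omega

/-- The open rectangle is convex. [folklore] -/
theorem convex_openRect (a b : ℤ × ℤ) : Convex ℝ (openRect a b) := by
  have h : openRect a b = ({z : ℂ | (a.1 : ℝ) - 1 / 2 < z.re} ∩ {z : ℂ | z.re < (b.1 : ℝ) + 1 / 2}) ∩
      ({z : ℂ | (a.2 : ℝ) - 1 / 2 < z.im} ∩ {z : ℂ | z.im < (b.2 : ℝ) + 1 / 2}) := by
    ext z; simp only [openRect, mem_inter_iff, mem_setOf_eq]
  rw [h]
  exact ((convex_halfSpace_re_gt _).inter (convex_halfSpace_re_lt _)).inter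
    ((convex_halfSpace_im_gt _).inter (convex_halfSpace_im_lt _))

/-- The lower-left site lies in the open rectangle of a nonempty box. [folklore] -/
theorem mem_openRect (a b : ℤ × ℤ) (hab : a.1 ≤ b.1 ∧ a.2 ≤ b.2) : (⟨(a.1 : ℝ), (a.2 : ℝ)⟩ : ℂ) ∈ openRect a b := by
  have h0 : ((a.1 : ℤ) : ℝ) ≤ b.1 := by exact_mod_cast hab.1
  have h1 : ((a.2 : ℤ) : ℝ) ≤ b.2 := by exact_mod_cast hab.2
  simp only [openRect, mem_setOf_eq]
  refine ⟨⟨by linarith, by linarith⟩, by linarith, by linarith⟩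

/-- **Boxes are simply connected lattice domains** (nonempty box `a ≤ b`). [folklore] -/
theorem isSimplyConnected_siteDomain_boxList (a b : ℤ × ℤ) (hab : a.1 ≤ b.1 ∧ a.2 ≤ b.2) :
    IsSimplyConnected (siteDomain (sitesOf (boxList a b))) := by
  rw [siteDomain_boxList_eq_openRect]
  haveI := (convex_openRect a b).contractibleSpace ⟨_, mem_openRect a b hab⟩
  change SimplyConnectedSpace (openRect a b)
  infer_instance

/-- Boxes are path connected lattice domains. [folklore] -/
theorem isPathConnected_siteDomain_boxList (a b : ℤ × ℤ) (hab : a.1 ≤ b.1 ∧ a.2 ≤ b.2) :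
    IsPathConnected (siteDomain (sitesOf (boxList a b))) := by
  rw [siteDomain_boxList_eq_openRect]
  exact (convex_openRect a b).isPathConnected ⟨_, mem_openRect a b hab⟩

/-! ### Gluing a box to a simply connected site-list domain -/

/-- The common sites of `S₁` and `S₂` are exactly those of the box `boxList c d`. [folklore] -/
def interIsBoxB (S₁ S₂ : List (ℤ × ℤ)) (c d : ℤ × ℤ) : Bool :=
  (S₁.all fun p => !decide (p ∈ S₂) || decide (p ∈ boxList c d)) &&
    ((boxList c d).all fun p => decide (p ∈ S₁) && decide (p ∈ S₂))

/-- Soundness of `interIsBoxB` as a set identity. [folklore] -/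
theorem sitesOf_inter_eq_of_check {S₁ S₂ : List (ℤ × ℤ)} {c d : ℤ × ℤ} (h : interIsBoxB S₁ S₂ c d = true) :
    sitesOf S₁ ∩ sitesOf S₂ = sitesOf (boxList c d) := by
  simp only [interIsBoxB, Bool.and_eq_true, List.all_eq_true, Bool.or_eq_true, Bool.not_eq_true',
    decide_eq_false_iff_not, decide_eq_true_eq] at h
  obtain ⟨h₁, h₂⟩ := h
  ext x
  simp only [mem_inter_iff, mem_sitesOf]
  constructor
  · rintro ⟨hx₁, hx₂⟩
    rcases h₁ _ hx₁ with h | h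
    · exact absurd hx₂ h
    · exact h
  · intro hx
    exact h₂ _ hx

/-- **The gluing check**: local one-sidedness of `S₁` and the box `boxList a b`, their common sites
form the box `boxList c d`, and `a ≤ b`, `c ≤ d` (nonempty box and overlap). [folklore] -/
def glueBoxCheck (S₁ : List (ℤ × ℤ)) (a b c d : ℤ × ℤ) : Bool :=
  locallyOneSidedB S₁ (boxList a b) && interIsBoxB S₁ (boxList a b) c d &&
    decide (a.1 ≤ b.1) && decide (a.2 ≤ b.2) && decide (c.1 ≤ d.1) && decide (c.2 ≤ d.2)

/-- **Gluing a box preserves simple connectivity** (van Kampen's easy half, Hatcher Lemma 1.15, in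
the tree's set form): if `Ω_{S₁}` is simply connected and `glueBoxCheck S₁ a b c d` accepts then
`Ω_{S₁ ++ boxList a b}` is simply connected. [cite: HatcherAT2002, Lemma 1.15] -/
theorem isSimplyConnected_siteDomain_append_of_check {S₁ : List (ℤ × ℤ)} {a b c d : ℤ × ℤ}
    (h₁ : IsSimplyConnected (siteDomain (sitesOf S₁))) (h : glueBoxCheck S₁ a b c d = true) :
    IsSimplyConnected (siteDomain (sitesOf (S₁ ++ boxList a b))) := by
  simp only [glueBoxCheck, Bool.and_eq_true, decide_eq_true_eq] at h
  obtain ⟨⟨⟨⟨⟨hloc, hint⟩, hab1⟩, hab2⟩, hcd1⟩, hcd2⟩ := h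
  rw [sitesOf_append, siteDomain_union_eq_of_locallyOneSided hloc]
  refine isSimplyConnected_union_of_isOpen (isOpen_siteDomain _) (isOpen_siteDomain _) h₁
    (isSimplyConnected_siteDomain_boxList a b ⟨hab1, hab2⟩) ?_
  rw [← siteDomain_inter, sitesOf_inter_eq_of_check hint]
  exact isPathConnected_siteDomain_boxList c d ⟨hcd1, hcd2⟩

/-- From the set predicate to the instance used by `BoundaryTP2`. [folklore] -/
theorem simplyConnectedSpace_of_isSimplyConnected {S : List (ℤ × ℤ)} (h : IsSimplyConnected (siteDomain (sitesOf S))) :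
    SimplyConnectedSpace (siteDomain {z : Site 2 | toPair z ∈ S}) := h

/-! ### The box instance of part XI's certificate -/

/-- **TP₂-violation certificate on a box**, hypothesis-free (interval `x_c ∈ [1/3, 1/2]`,
axiom-clean): if part XI's check accepts on the site list of a nonempty box then the universally
quantified TP₂ statement (the shape of `BoundaryTP2`) is false. (No box is known to violate TP₂ —
enumeration evidence on the route says none up to `7 × 6` does; this packages the pipeline.) [folklore] -/
theorem not_tp2_forall_of_boxCheck (a b : ℤ × ℤ) (hab : a.1 ≤ b.1 ∧ a.2 ≤ b.2) (p₁ p₂ p₃ p₄ : Site 2)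
    (l₁₂ l₃₄ l₁₄ l₂₃ : List (ℤ × ℤ)) {d : ℕ}
    (h : tp2ViolationCheck (boxList a b) (toPair p₁) (toPair p₂) (toPair p₃) (toPair p₄) l₁₂ l₃₄ l₁₄ l₂₃ d (1 / 3) (1 / 2) = true) :
    ¬ (∀ (Ω : Set ℂ) (δ : ℝ) (p₁ p₂ p₃ p₄ : Site 2), Bornology.IsBounded Ω → SimplyConnectedSpace Ω → 0 < δ →
      (∀ (P : SAW.DomainSAW Ω δ p₁ p₃) (Q : SAW.DomainSAW Ω δ p₂ p₄), ∃ v, v ∈ P.walk.support ∧ v ∈ Q.walk.support) →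
      (∃ (P : SAW.DomainSAW Ω δ p₁ p₂) (Q : SAW.DomainSAW Ω δ p₃ p₄), List.Disjoint P.walk.support Q.walk.support) →
      (∃ (P : SAW.DomainSAW Ω δ p₁ p₄) (Q : SAW.DomainSAW Ω δ p₂ p₃), List.Disjoint P.walk.support Q.walk.support) →
      SAW.weight Ω δ p₁ p₃ Set.univ * SAW.weight Ω δ p₂ p₄ Set.univ ≤
        SAW.weight Ω δ p₁ p₂ Set.univ * SAW.weight Ω δ p₃ p₄ Set.univ) :=
  not_tp2_forall_of_check (boxList a b) p₁ p₂ p₃ p₄ l₁₂ l₃₄ l₁₄ l₂₃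
    (simplyConnectedSpace_of_isSimplyConnected (isSimplyConnected_siteDomain_boxList a b hab))
    criticalFugacity_mem_Icc_third_half.1 criticalFugacity_mem_Icc_third_half.2 h

/-! ### Kernel regression examples -/

/-- An L-shape: the `4 × 2` bar `[0,3] × [0,1]` glued to the `2 × 6` bar `[2,3] × [0,5]` along the
`2 × 2` box `[2,3] × [0,1]` passes the gluing check (locally one-sided, box overlap) … -/
example : glueBoxCheck (boxList (0, 0) (3, 1)) (2, 0) (3, 5) (2, 0) (3, 1) = true := by decide +kernel

/-- … hence its lattice domain is simply connected. -/
example : IsSimplyConnected (siteDomain (sitesOf (boxList (0, 0) (3, 1) ++ boxList (2, 0) (3, 5)))) :=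
  isSimplyConnected_siteDomain_append_of_check (isSimplyConnected_siteDomain_boxList (0, 0) (3, 1) (by decide))
    (a := (2, 0)) (b := (3, 5)) (c := (2, 0)) (d := (3, 1)) (by decide +kernel)

/-- Two boxes touching only along an edge are NOT locally one-sided (the shared edge belongs to the
union's domain but to neither part), and the check rejects them: glue along an overlap instead. -/
example : locallyOneSidedB (boxList (0, 0) (1, 1)) (boxList (2, 0) (3, 1)) = false := by decide +kernel

end Literature.Computation.FiniteGraph
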